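import Literature.NumberTheory.Rogawski1990.ArchCompactPlaceLineDerivatives         -- ★ p842172 (this seat): `contDiff_coe_circleDiagonal_angles`, the definite-place `C^∞`; brings ★ `ArchLocalTorusOrbitalDeriv` (`coe_conj_archLocal`), Hörmander ★
import Literature.NumberTheory.Automorphic.ArchLocalTorusOrbitalCompactWall           -- ★ p839953 (C-cw) (F0P3a-p06): `isCompact_setOf_exists_conj_circleDiagonal_mem_of_blocks` (joint properness over block-separated compacta)
import Literature.NumberTheory.Automorphic.ArchLocalTorusOrbitalCompactWallContinuity -- ★ `isOpen_setOf_blockSeparated`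
import HarnessLib

/-!
# The per-place torus orbital function is `C^∞` IN ALL THE ANGLES on the block-separated set — through every COMPACT wall, in any signature, to all orders
# (ROAD A (A1), `N`-general; Rogawski 1990 §8.2 pp. 122–123, §8.4 p. 126; Varadarajan 1989 §2.4 Thm. 8; Hörmander Thm. 1.1.9)

Topic `NumberTheory/Automorphic`; namespaces `Literature.Analysis.Calculus` (§1, generic) and `Literature.NumberTheory.Automorphic.UnitaryGroup` (§2).  THEOREMS ONLY (no `def`, no instance,
no notation, no axiom, no named fact, no `sorry`).  Cell `pub/hodgecm-mathlib`, ENGINE T1 (crux H413 = `stmt-HodgeConjecture-24833`); floor-1½ preparation, count-neutral, under row (S-d) ∕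
`stub_SdCanonical` of the «SdArch» pay-down line: brick **ROAD A (A1) «`C^∞` ACROSS THE COMPACT WALLS»** (F0P3a-p03 (g10) census c3af6e58 §2 (A1); LEAD F0P3a-plan (g9) WORD T8-126 (1),
2026-09-01; author F0P3a-p05 (g12)).  Sequel of ★ `Rogawski1990/ArchCompactPlaceLineDerivatives` ((L_{U(3)})-engine: the DEFINITE place, all angles, all orders) and of ★ (C-cw) FILE A′∕B′
(`ArchLocalTorusOrbitalDeriv`, `…CompactWallDeriv`: order ONE along one-angle curves).

THE MATHEMATICS.  `G_w = U(σ_w diag α)(ℂ)` of ANY signature, real weights `e_i = re σ_w(α_i) ≠ 0`; a labelling `b` of the coordinates such that distinct coordinates with the same label have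
weights of the same sign (`hsign`: the coincidences `z_i = z_j` allowed inside a block are COMPACT walls — centraliser `U(2) × …`).  On the open BLOCK-SEPARATED set of angles
`U = {θ | b_i ≠ b_j ⇒ ζ_i e^{iθ_i} ≠ ζ_j e^{iθ_j}}` conjugation is jointly proper (★ (C-cw) `isCompact_setOf_exists_conj_circleDiagonal_mem_of_blocks`): for a compact ball `B ⊆ U` of angles there is ONE
compact `S ⊆ G_w` off which `g ↦ Θ(↑↑(g·diag(ζe^{iθ})·g⁻¹))` vanishes for every `θ ∈ B`, whenever `Θ` has compact support on `G_w`.  Hence (§1, generic: Hörmander's theorem ★ after a smooth cutoff in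
the parameter, the measure only finite on compacts, the integrand vanishing off a fixed compact for parameters near `X₀`) the torus orbital function
`F_Θ(θ) = ∫_{G_w} Θ(↑↑(g·diag(ζ_i e^{iθ_i})·g⁻¹)) dν(g)` is `C^∞` in all the angles on `U` (§2) — for `b` injective this is smoothness on the regular set, for `b = (0,1,0)` on `U(2,1)` it is
smoothness THROUGH the compact wall `z_0 = z_2` (print's `γ₀′` with centraliser the compact `U(2) × U(1)`), for a definite place and `b` constant it is ★ the engine's statement on all of `ℝ^N`.
This is step (A1) of the in-house road to the rank-2 central limit formula (order 3 across the compact wall), and the all-orders form of ★ (C-cw)∕(J-cw).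
* §1 `contDiffAt_integral_comp_of_contDiff_of_support` (generic, `ContDiffAt` at `X₀` from a uniform compact support near `X₀`).
* §2 `exists_closedBall_isCompact_apply_conj_circleDiagonal_angles_eq_zero_of_blocks` (the uniform compact support on a ball of angles), **`contDiffOn_integral_comp_conj_circleDiagonal_angles_of_blocks`**.
HONEST LABEL: HC_CM is proved only modulo the printed citations until rung 0 closes; real analysis on a real group, pays nothing by itself; the NONCOMPACT walls (where `F_Θ` is NOT smooth —
Harish-Chandra's jump relations) are not touched.

## References
* [Rogawski1990] J. D. Rogawski, *Automorphic Representations of Unitary Groups in Three Variables*, Ann. of Math. Stud. 123 (1990), §8.2 pp. 122–123 (`γ₀′`, compact centraliser), §8.4 p. 126.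
* [Varadarajan1989] V. S. Varadarajan, *An Introduction to Harmonic Analysis on Semisimple Lie Groups* (1989), §2.4 Thm. 8 (orbital integrals smooth where the centraliser is compact).
* [HormanderALPDO1] L. Hörmander, *The Analysis of Linear Partial Differential Operators I*, 2nd ed. (1990), Thm. 1.1.9.
* [DeitmarEchterhoff2014] A. Deitmar, S. Echterhoff, *Principles of Harmonic Analysis*, 2nd ed. (2014), Lemma 9.3.3.
-/

set_option autoImplicit false

noncomputable section

open MeasureTheory Measure Filter Topology Set Function Metric NumberField NumberField.InfinitePlace
open scoped ContDiff

/-! ## §1 Smooth dependence on a finite-dimensional parameter: uniform compact support near the base point, measure finite on compacts -/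

namespace Literature.Analysis.Calculus

section Generic

variable {Y : Type*} [TopologicalSpace Y] [T2Space Y] [MeasurableSpace Y] [OpensMeasurableSpace Y]
  {P : Type*} [NormedAddCommGroup P] [NormedSpace ℝ P]
  {V : Type*} [NormedAddCommGroup V] [NormedSpace ℝ V] [FiniteDimensional ℝ V]
  {F : Type*} [NormedAddCommGroup F] [NormedSpace ℝ F] [CompleteSpace F]

/-- **SMOOTH DEPENDENCE ON PARAMETERS, UNIFORM COMPACT SUPPORT**: `μ` finite on compacts, `Ψ : P × V → F` smooth (`V` finite-dimensional), `y : Y → P` continuous; if there are a compact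
`S ⊆ Y` and a neighbourhood `U` of `X₀` with `Ψ(y t, X) = 0` for `t ∉ S`, `X ∈ U`, then `X ↦ ∫_Y Ψ(y t, X) dμ(t)` is `C^∞` at `X₀`.  (Hörmander ★ `contDiff_integral_of_dominated_iteratedFDeriv`
after a smooth cutoff `χ = 1` near `X₀` with `tsupport χ ⊆ U`: the cut integrand `(χ·Ψ)(inr X + (y t, 0))` vanishes identically in `X` for `t ∉ S`, and its `X`-derivatives are bounded on
`S × tsupport χ` by ★ `continuous_iteratedFDeriv_comp_affine`.) [cite: HormanderALPDO1, Thm. 1.1.9] [cite: DeitmarEchterhoff2014, Lemma 9.3.3] -/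
theorem contDiffAt_integral_comp_of_contDiff_of_support (μ : Measure Y) [IsFiniteMeasureOnCompacts μ] (Ψ : P × V → F) (hΨ : ContDiff ℝ ∞ Ψ) (y : Y → P) (hy : Continuous y)
    (X₀ : V) {S : Set Y} (hS : IsCompact S) {U : Set V} (hU : U ∈ 𝓝 X₀) (h0 : ∀ t ∉ S, ∀ X ∈ U, Ψ (y t, X) = 0) :
    ContDiffAt ℝ ∞ (fun X : V => ∫ t, Ψ (y t, X) ∂μ) X₀ := by
  -- a smooth compactly supported cutoff `χ = 1` near `X₀` with `tsupport χ ⊆ U` (Mathlib bump on the Euclidean model of `V`)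
  set e : V ≃L[ℝ] EuclideanSpace ℝ (Fin (Module.finrank ℝ V)) := toEuclidean with he
  obtain ⟨ε, hε, hεU⟩ : ∃ ε > 0, Metric.closedBall (e X₀) ε ⊆ e.symm ⁻¹' U := by
    have hU' : e.symm ⁻¹' U ∈ 𝓝 (e X₀) := by
      refine e.symm.continuous.continuousAt.preimage_mem_nhds ?_
      rw [ContinuousLinearEquiv.symm_apply_apply]; exact hU
    exact Metric.nhds_basis_closedBall.mem_iff.1 hU'
  let bump : ContDiffBump (e X₀) := ⟨ε / 2, ε, half_pos hε, half_lt_self hε⟩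
  set χ : V → ℝ := fun X => bump (e X) with hχ
  have hχd : ContDiff ℝ ∞ χ := bump.contDiff.comp e.contDiff
  have hχc : HasCompactSupport χ := bump.hasCompactSupport.comp_homeomorph e.toHomeomorph
  have hχ1 : ∀ᶠ X in 𝓝 X₀, χ X = 1 := by
    have hev : ∀ᶠ X in 𝓝 X₀, e X ∈ Metric.closedBall (e X₀) (ε / 2) :=
      e.continuous.continuousAt.eventually_mem (Metric.closedBall_mem_nhds _ (half_pos hε))
    exact hev.mono fun X hX => bump.one_of_mem_closedBall hX
  have hχU : ∀ X, χ X ≠ 0 → X ∈ U := by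
    intro X hX
    have hXs : e X ∈ Metric.closedBall (e X₀) ε := bump.tsupport_eq ▸ subset_tsupport _ (Function.mem_support.2 hX)
    have := hεU hXs
    rwa [Set.mem_preimage, ContinuousLinearEquiv.symm_apply_apply] at this
  -- the cut integrand in the affine presentation `Ψχ (L X + c t)`
  set Ψχ : P × V → F := fun q => χ q.2 • Ψ q with hΨχ
  have hΨχd : ContDiff ℝ ∞ Ψχ := (hχd.comp contDiff_snd).smul hΨ
  set L : V →L[ℝ] P × V := ContinuousLinearMap.inr ℝ P V with hL
  set c : Y → P × V := fun t => (y t, 0) with hc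
  have hcc : Continuous c := hy.prodMk continuous_const
  have hLc : ∀ t X, L X + c t = (y t, X) := fun t X => by
    rw [hL, hc, ContinuousLinearMap.inr_apply, Prod.mk_add_mk, zero_add, add_zero]
  set H : Y → V → F := fun t X => Ψχ (L X + c t) with hH
  have hHeq : ∀ t, H t = fun X => χ X • Ψ (y t, X) := fun t => by funext X; rw [hH]; simp only [hΨχ, hLc]
  -- off `S` the cut integrand vanishes identically, hence so do all its derivatives
  have hHS : ∀ t ∉ S, H t = 0 := by
    intro t ht; rw [hHeq t]; funext X
    by_cases hX : χ X = 0
    · rw [hX, zero_smul, Pi.zero_apply]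
    · rw [h0 t ht X (hχU X hX), smul_zero, Pi.zero_apply]
  have hDS : ∀ (n : ℕ) (t : Y), t ∉ S → ∀ X, iteratedFDeriv ℝ n (H t) X = 0 := by
    intro n t ht X; rw [hHS t ht]; simp
  -- Hörmander's hypotheses
  have h1 : ∀ t, ContDiff ℝ ∞ (H t) := fun t => hΨχd.comp ((L.contDiff).add contDiff_const)
  have h2 : ∀ (n : ℕ) (X : V), AEStronglyMeasurable (fun t => iteratedFDeriv ℝ n (H t) X) μ := fun n X =>
    ((continuous_iteratedFDeriv_comp_affine_param hΨχd L hcc n X).stronglyMeasurable_of_hasCompactSupport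
      (HasCompactSupport.intro hS fun t ht => hDS n t ht X)).aestronglyMeasurable
  have h3 : ∀ n : ℕ, ∃ g : Y → ℝ, Integrable g μ ∧ ∀ t X, ‖iteratedFDeriv ℝ n (H t) X‖ ≤ g t := by
    intro n
    have hjc : Continuous fun q : Y × V => iteratedFDeriv ℝ n (fun X => Ψχ (L X + c q.1)) q.2 := continuous_iteratedFDeriv_comp_affine hΨχd L hcc n
    obtain ⟨B, hB⟩ := (hS.prod hχc.isCompact).exists_bound_of_continuousOn (f := fun q : Y × V => iteratedFDeriv ℝ n (fun X => Ψχ (L X + c q.1)) q.2) hjc.continuousOn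
    refine ⟨S.indicator fun _ => max B 0, ?_, fun t X => ?_⟩
    · exact (integrableOn_const (hS.measure_lt_top (μ := μ)).ne).integrable_indicator hS.measurableSet
    by_cases ht : t ∈ S
    · rw [Set.indicator_of_mem ht]
      by_cases hX : X ∈ tsupport χ
      · exact (hB (t, X) ⟨ht, hX⟩).trans (le_max_left _ _)
      · have hsupp : tsupport (H t) ⊆ tsupport χ := by rw [hHeq t]; exact tsupport_smul_subset_left _ _
        have h0' : iteratedFDeriv ℝ n (H t) X = 0 := by
          by_contra hne
          exact hX (hsupp (support_iteratedFDeriv_subset n (Function.mem_support.2 hne)))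
        rw [h0', norm_zero]; exact le_max_right _ _
    · rw [Set.indicator_of_notMem ht, hDS n t ht X, norm_zero]
  have hsmooth : ContDiff ℝ ∞ fun X => ∫ t, H t X ∂μ := contDiff_integral_of_dominated_iteratedFDeriv h1 h2 h3
  -- near `X₀` the cut integral is the integral
  refine (hsmooth.contDiffAt (x := X₀)).congr_of_eventuallyEq (hχ1.mono fun X hX1 => ?_)
  refine integral_congr_ae (Eventually.of_forall fun t => ?_)
  simp only [hH, hΨχ, hLc, hX1, one_smul]

end Generic

end Literature.Analysis.Calculus

/-! ## §2 The torus orbital function is smooth in all the angles on the block-separated set -/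

namespace Literature.NumberTheory.Automorphic.UnitaryGroup

open Literature.Analysis.Calculus
open scoped Matrix MatrixGroups
open scoped Matrix.Norms.Operator

section Blocks

variable (L : Type) [Field L] (N : ℕ) (α : Fin N → L) (w : {w : InfinitePlace L // IsComplex w})
  {E : Type*} [NormedAddCommGroup E] [NormedSpace ℝ E] [CompleteSpace E]

omit [NormedSpace ℝ E] [CompleteSpace E] in
/-- **UNIFORM COMPACT SUPPORT ON A BALL OF BLOCK-SEPARATED ANGLES**: at a block-separated angle `θ₀` there are `δ > 0` and a compact `S ⊆ G_w` such that `Θ(↑↑(g·diag(ζe^{iθ})·g⁻¹)) = 0`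
for all `g ∉ S` and all `θ` in the closed ball of radius `δ` (★ (C-cw) joint properness over the compact image of the ball, which stays block-separated: ★ `isOpen_setOf_blockSeparated`).
[cite: Rogawski1990, §8.2 pp. 122–123] [cite: DeitmarEchterhoff2014, Lemma 9.3.3] -/
theorem exists_closedBall_isCompact_apply_conj_circleDiagonal_angles_eq_zero_of_blocks (hα : ∀ i, α i ≠ 0) (hreal : ∀ i, (w.1.embedding (α i)).im = 0)
    {ι : Type*} (b : Fin N → ι) (hsign : ∀ i j, i ≠ j → b i = b j → 0 < (w.1.embedding (α i)).re * (w.1.embedding (α j)).re)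
    (Θ : Matrix (Fin N) (Fin N) ℂ → E) (hfc : HasCompactSupport fun k : archLocal L N (Matrix.diagonal α) w => Θ (((k : GL (Fin N) ℂ) : Matrix (Fin N) (Fin N) ℂ)))
    (ζ : Fin N → Circle) (θ₀ : Fin N → ℝ) (hθ₀ : ∀ i j, b i ≠ b j → ζ i * Circle.exp (θ₀ i) ≠ ζ j * Circle.exp (θ₀ j)) :
    ∃ δ : ℝ, 0 < δ ∧ ∃ S : Set (archLocal L N (Matrix.diagonal α) w), IsCompact S ∧ ∀ g ∉ S, ∀ θ ∈ Metric.closedBall θ₀ δ,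
      Θ ((((g * ⟨circleDiagonal N fun i => ζ i * Circle.exp (θ i), circleDiagonal_mem_archLocal_diagonal L N α w _⟩ * g⁻¹ :
        archLocal L N (Matrix.diagonal α) w) : GL (Fin N) ℂ) : Matrix (Fin N) (Fin N) ℂ)) = 0 := by
  have hzc : Continuous fun θ : Fin N → ℝ => fun i => ζ i * Circle.exp (θ i) :=
    continuous_pi fun i => continuous_const.mul (Circle.exp.continuous.comp (continuous_apply i))
  have hopen : IsOpen {z : Fin N → Circle | ∀ i j, b i ≠ b j → z i ≠ z j} := isOpen_setOf_blockSeparated b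
  obtain ⟨δ, hδ, hball⟩ : ∃ δ > 0, Metric.closedBall θ₀ δ ⊆ (fun θ : Fin N → ℝ => fun i => ζ i * Circle.exp (θ i)) ⁻¹' {z : Fin N → Circle | ∀ i j, b i ≠ b j → z i ≠ z j} := by
    obtain ⟨ε, hε, hεball⟩ := Metric.mem_nhds_iff.1 ((hopen.preimage hzc).mem_nhds (show θ₀ ∈ _ from hθ₀))
    exact ⟨ε / 2, half_pos hε, (Metric.closedBall_subset_ball (half_lt_self hε)).trans hεball⟩
  have hKc : IsCompact ((fun θ : Fin N → ℝ => fun i => ζ i * Circle.exp (θ i)) '' Metric.closedBall θ₀ δ) := (isCompact_closedBall θ₀ δ).image hzc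
  have hKsep : (fun θ : Fin N → ℝ => fun i => ζ i * Circle.exp (θ i)) '' Metric.closedBall θ₀ δ ⊆ {z : Fin N → Circle | ∀ i j, b i ≠ b j → z i ≠ z j} := by
    rintro _ ⟨θ, hθ, rfl⟩; exact hball hθ
  have hS := isCompact_setOf_exists_conj_circleDiagonal_mem_of_blocks L N α w hα hreal b hsign hKc hKsep hfc.isCompact
  refine ⟨δ, hδ, _, hS, fun g hg θ hθ => ?_⟩
  exact image_eq_zero_of_notMem_tsupport (f := fun k : archLocal L N (Matrix.diagonal α) w => Θ (((k : GL (Fin N) ℂ) : Matrix (Fin N) (Fin N) ℂ)))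
    (fun h => hg ⟨_, ⟨θ, hθ, rfl⟩, h⟩)

variable [MeasurableSpace (archLocal L N (Matrix.diagonal α) w)] [BorelSpace (archLocal L N (Matrix.diagonal α) w)]

/-- **ROAD A (A1): THE TORUS ORBITAL FUNCTION IS `C^∞` IN ALL THE ANGLES ON THE BLOCK-SEPARATED SET** — `G_w = U(σ_w diag α)(ℂ)` of any signature, `ν` finite on compacts, `Θ` smooth on `M_N(ℂ)` with
compact support on `G_w`, `b` a constant-sign labelling: `θ ↦ ∫_{G_w} Θ(↑↑(g·diag(ζ_i e^{iθ_i})·g⁻¹)) dν(g)` is `ContDiffOn ℝ ∞` on `{θ | b_i ≠ b_j ⇒ ζ_i e^{iθ_i} ≠ ζ_j e^{iθ_j}}` — through every compact wall,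
to all orders (§1 at each point of the open set with the uniform compact support of the previous theorem; `Ψ((A,B), θ) = Θ(A·diag(ζe^{iθ})·B)`, `y(g) = (↑g, ↑g⁻¹)`).
[cite: Rogawski1990, §8.2 pp. 122–123; §8.4 p. 126] [cite: Varadarajan1989, §2.4 Thm. 8] [cite: HormanderALPDO1, Thm. 1.1.9] -/
theorem contDiffOn_integral_comp_conj_circleDiagonal_angles_of_blocks (hα : ∀ i, α i ≠ 0) (hreal : ∀ i, (w.1.embedding (α i)).im = 0)
    {ι : Type*} (b : Fin N → ι) (hsign : ∀ i j, i ≠ j → b i = b j → 0 < (w.1.embedding (α i)).re * (w.1.embedding (α j)).re)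
    (ν : Measure (archLocal L N (Matrix.diagonal α) w)) [IsFiniteMeasureOnCompacts ν]
    (Θ : Matrix (Fin N) (Fin N) ℂ → E) (hΘ : ContDiff ℝ ∞ Θ) (hfc : HasCompactSupport fun k : archLocal L N (Matrix.diagonal α) w => Θ (((k : GL (Fin N) ℂ) : Matrix (Fin N) (Fin N) ℂ)))
    (ζ : Fin N → Circle) :
    ContDiffOn ℝ ∞ (fun θ : Fin N → ℝ => ∫ g : archLocal L N (Matrix.diagonal α) w,
        Θ ((((g * ⟨circleDiagonal N fun i => ζ i * Circle.exp (θ i), circleDiagonal_mem_archLocal_diagonal L N α w _⟩ * g⁻¹ :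
          archLocal L N (Matrix.diagonal α) w) : GL (Fin N) ℂ) : Matrix (Fin N) (Fin N) ℂ)) ∂ν)
      {θ : Fin N → ℝ | ∀ i j, b i ≠ b j → ζ i * Circle.exp (θ i) ≠ ζ j * Circle.exp (θ j)} := by
  intro θ₀ hθ₀
  refine ContDiffAt.contDiffWithinAt ?_
  -- the jointly smooth integrand and the continuous parameter map
  set Ψ : (Matrix (Fin N) (Fin N) ℂ × Matrix (Fin N) (Fin N) ℂ) × (Fin N → ℝ) → E :=
    fun q => Θ (q.1.1 * ((circleDiagonal N fun i => ζ i * Circle.exp (q.2 i) : GL (Fin N) ℂ) : Matrix (Fin N) (Fin N) ℂ) * q.1.2) with hΨ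
  have hΨd : ContDiff ℝ ∞ Ψ :=
    hΘ.comp (((contDiff_fst.comp contDiff_fst).mul ((contDiff_coe_circleDiagonal_angles N ζ).comp contDiff_snd)).mul (contDiff_snd.comp contDiff_fst))
  set y : archLocal L N (Matrix.diagonal α) w → Matrix (Fin N) (Fin N) ℂ × Matrix (Fin N) (Fin N) ℂ :=
    fun g => (((g : GL (Fin N) ℂ) : Matrix (Fin N) (Fin N) ℂ), (((g⁻¹ : archLocal L N (Matrix.diagonal α) w) : GL (Fin N) ℂ) : Matrix (Fin N) (Fin N) ℂ)) with hy
  have hyc : Continuous y :=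
    (Units.continuous_val.comp continuous_subtype_val).prodMk ((Units.continuous_val.comp continuous_subtype_val).comp continuous_inv)
  have hΨy : ∀ (g : archLocal L N (Matrix.diagonal α) w) (θ : Fin N → ℝ), Ψ (y g, θ) =
      Θ ((((g * ⟨circleDiagonal N fun i => ζ i * Circle.exp (θ i), circleDiagonal_mem_archLocal_diagonal L N α w _⟩ * g⁻¹ :
        archLocal L N (Matrix.diagonal α) w) : GL (Fin N) ℂ) : Matrix (Fin N) (Fin N) ℂ)) := fun g θ => by
    simp only [hΨ, hy, coe_conj_archLocal]
  -- the uniform compact support near `θ₀`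
  obtain ⟨δ, hδ, S, hS, hS0⟩ := exists_closedBall_isCompact_apply_conj_circleDiagonal_angles_eq_zero_of_blocks L N α w hα hreal b hsign Θ hfc ζ θ₀ hθ₀
  have key := contDiffAt_integral_comp_of_contDiff_of_support ν Ψ hΨd y hyc θ₀ hS (Metric.closedBall_mem_nhds θ₀ hδ)
    (fun g hg θ hθ => by rw [hΨy]; exact hS0 g hg θ hθ)
  have hfun : (fun θ : Fin N → ℝ => ∫ g : archLocal L N (Matrix.diagonal α) w,
      Θ ((((g * ⟨circleDiagonal N fun i => ζ i * Circle.exp (θ i), circleDiagonal_mem_archLocal_diagonal L N α w _⟩ * g⁻¹ :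
        archLocal L N (Matrix.diagonal α) w) : GL (Fin N) ℂ) : Matrix (Fin N) (Fin N) ℂ)) ∂ν) = fun X => ∫ t, Ψ (y t, X) ∂ν := by
    funext θ
    exact integral_congr_ae (Eventually.of_forall fun g => (hΨy g θ).symm)
  rw [hfun]
  exact key

end Blocks

end Literature.NumberTheory.Automorphic.UnitaryGroup

end
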